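import Mathlib
import Summits.NavierStokesRegularity.OSWSelfSimilar.SheetNSLineTorusCascadeLink
import HarnessLib

/-!
# Viscous CLM on the torus (`a = 0`, `σ = 2`): SPENDING THE SPARE FACTOR — shorter windows in the pole comparison, a
# schedule abstraction, and the fully-kernel blow-up threshold improved from `48ν` to `48e^{−7/36}ν < 40ν` (horizon `(log 2 − 7/36)/ν`)

HONEST FRAMING (cell ns-blowup GROUP B «PROFILE SEARCH», zone Z3, row Z3-U addendum A-F2 of `HOME/profile/z3/CENSUS-Z3.md`;
human rulings D-0035/D-0074; Z3-TWIN lineage): **1-D MODEL (viscous Constantin–Lax–Majda equation `ω_t = ω Hω + ν ω_xx` on `𝕋`);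
ODE comparison on Fourier-coefficient families + the classical-solution link, kernel-checked; not Euler, not Navier–Stokes;
«violates: none — MODEL». Everything here is DATUM-FREE (no script table).**

OBJECT: the sine-datum cascade `IsSineCascade ν c e` and the periodised Schochet pole `pole ν c k t = 24ν k (c/24ν)^k e^{−νkt}` of
`SheetNSLineTorusCascade` (p498092, eng-3). There `lower_step` crosses mode `k` over a window of length `log 2/(νk(k−1))` and lands with
the SPARE FACTOR `(k+1)/k`; the windows telescope to `log 2/ν`, whence blow-up at `t = log 2/ν` for `c ≥ 48ν`. HERE the spare factor is
spent on SHORTER windows: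

* `lower_step_spare` — with the window `log(2(k+1)/(k+2))/(νk(k−1))` (any `τ` at least that long) mode `k` lands EXACTLY on the pole:
  `m_k(t) ≤ e_k(t)` for `t ≥ α + τ` (the Duhamel gain `G(t) − G(α)` needs only `G(α) ≤ (k+2)/(2(k+1))·G(t)` instead of `½G(t)`);
* `pole_le_of_schedule` — induction over the triangular cascade for ANY schedule `β : ℕ → ℝ` with `β 1 = 0` and
  `β n + log(2(n+2)/(n+3))/(ν(n+1)n) ≤ β (n+1)`: all modes `j ≤ k` dominate the pole from time `β k` on;
  `pole_lower_bound_of_schedule`, `unbounded_of_schedule` — if `β k ≤ S` for all `k ≥ 1` then `m_k(t) ≤ e_k(t)` for all `k` and `t ≥ S`,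
  and `k ↦ e_k(S)` is unbounded as soon as `24ν e^{νS} ≤ c` (a better schedule bound `S` is all a successor has to supply);
* the CLOSED-FORM schedule `β k = (log 2·(1 − 1/k) − (7/36 − 1/(3k) + 1/(6(k+1)) + 1/(6(k+2))))/ν` (windows `(log 2 − 1/(k+2))/(νk(k−1))`,
  admissible by `log((k+2)/(k+1)) ≥ 1/(k+2)`; partial fractions `1/((k−1)k(k+2)) = 1/(3(k−1)) − 1/(2k) + 1/(6(k+2))`) has `β k ≤ (log 2 − 7/36)/ν`:
  `pole_lower_bound_spare` — **for every `k` and every `t ≥ (log 2 − 7/36)/ν`: `24ν k (c e^{−νt}/24ν)^k ≤ e_k(t)`**;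
  `unbounded_of_le_spare` — **if `48 e^{−7/36} ν ≤ c` then `k ↦ e_k((log 2 − 7/36)/ν)` is unbounded**; `unbounded_of_le_forty` — the same
  for `c ≥ 40ν` (`48e^{−7/36} = 39.518… ≤ 40` by `e^{7/36} ≥ 1 + 7/36 + (7/36)²/2 ≥ 6/5`); `datum_lt_forty_of_bounded` (census form);
* PDE level via `horizon_lt_of_cascade_unbounded` (eng-3, p512652): `horizon_lt_of_le_spare`, **`horizon_lt_of_le_forty` — no classical
  `2π`-periodic solution of the MODEL PDE from `−c sin x` with `c ≥ 40ν` exists on `[0, (log 2 − 7/36)/ν]`** (`(log 2 − 7/36) = 0.4987…`).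
READING: the datum-free kernel interval for sine data moves from `[12ν, 48ν]` to `[12ν, 40ν)` (precisely `48e^{−7/36}ν = 39.52ν`); the exact
window sum `Σ_{k≥2} log(2(k+1)/(k+2))/(k(k−1)) = 0.47337` would give `24e^{0.47337} = 38.53ν` through the same `unbounded_of_schedule` — not
typed (needs rational enclosures of finitely many logarithms); the located threshold is `19.7756ν` and the certified bracket
`[19.7755478, 19.7766876]ν` (`SheetNSLineTorusCascadeLinkCertified` / `…SynthesisCertified`, script data + kernel). bears_on: LADDER-NS N5 /
zone Z3 (row Z3-U) → N1 linear core. WHAT THIS IS NOT: not NS; no number outside the kernel; no definitions.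
-/

namespace Summit.NavierStokesRegularity.OSWSelfSimilar
namespace SheetNSLineTorusCascade

open Finset Real Set

variable {ν c : ℝ} {e : ℕ → ℝ → ℝ}

/-! ### The spare window step -/

/-- **THE SPARE WINDOW STEP.** Let `k ≥ 2`, `α ≥ 0`, and suppose every mode `j < k` dominates the pole profile on `[α, ∞)`. Then for
every `τ ≥ log(2(k+1)/(k+2))/(νk(k−1))` and every `t ≥ α + τ`: `m_k(t) ≤ e_k(t)` (no spare factor left, shorter window than
`lower_step`'s `log 2/(νk(k−1))`). [new here — MODEL] -/
theorem lower_step_spare (he : IsSineCascade ν c e) (hν : 0 < ν) (hc : 0 ≤ c) {k : ℕ} (hk : 2 ≤ k) {α : ℝ} (hα : 0 ≤ α)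
    (hyp : ∀ j, j < k → ∀ s, α ≤ s → pole ν c j s ≤ e j s) {τ : ℝ}
    (hτ : Real.log (2 * ((k : ℝ) + 1) / ((k : ℝ) + 2)) / (ν * (k : ℝ) * ((k : ℝ) - 1)) ≤ τ) :
    ∀ t, α + τ ≤ t → pole ν c k t ≤ e k t := by
  intro t ht
  have hk1 : (1 : ℝ) < k := by exact_mod_cast hk
  have hkpos : (0 : ℝ) < k := by linarith
  have hk1' : (0 : ℝ) < (k : ℝ) - 1 := by linarith
  have hkk : 0 < (k : ℝ) ^ 2 - k := by nlinarith
  have hνkk : 0 < ν * ((k : ℝ) ^ 2 - k) := mul_pos hν hkk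
  have hratio_pos : 0 < 2 * ((k : ℝ) + 1) / ((k : ℝ) + 2) := by positivity
  have hratio : 1 < 2 * ((k : ℝ) + 1) / ((k : ℝ) + 2) := by
    rw [lt_div_iff₀ (by positivity)]; linarith
  have hlogpos : 0 < Real.log (2 * ((k : ℝ) + 1) / ((k : ℝ) + 2)) := Real.log_pos hratio
  have hτpos : 0 < τ := lt_of_lt_of_le (div_pos hlogpos (mul_pos (mul_pos hν hkpos) hk1')) hτ
  have hαt : α < t := by linarith
  set q : ℝ := c / (24 * ν) with hq
  have hq0 : 0 ≤ q := div_nonneg hc (by positivity)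
  set B : ℝ := 48 * ν * ((k : ℝ) + 1) * q ^ k with hB
  have hB0 : 0 ≤ B := by positivity
  set G : ℝ → ℝ := fun s => B * exp (ν * ((k : ℝ) ^ 2 - k) * s) with hG
  have hG' : ∀ s, HasDerivAt G (B * (exp (ν * ((k : ℝ) ^ 2 - k) * s) * (ν * ((k : ℝ) ^ 2 - k)))) s := by
    intro s
    have := ((hasDerivAt_id s).const_mul (ν * ((k : ℝ) ^ 2 - k))).exp.const_mul B
    simpa using this
  have hGconv : ∀ s, B * (exp (ν * ((k : ℝ) ^ 2 - k) * s) * (ν * ((k : ℝ) ^ 2 - k)))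
      = exp (ν * (k : ℝ) ^ 2 * s) * ((1 / 2) * ∑ p ∈ antidiagonal k, pole ν c p.1 s * pole ν c p.2 s) := by
    intro s
    rw [pole_conv]
    have hsplit : exp (ν * ((k : ℝ) ^ 2 - k) * s) = exp (ν * (k : ℝ) ^ 2 * s) * exp (-(ν * (k : ℝ) * s)) := by
      rw [← exp_add]; congr 1; ring
    rw [hsplit, hB]
    have h3 : ((k : ℝ) ^ 3 - k) = ((k : ℝ) ^ 2 - k) * ((k : ℝ) + 1) := by ring
    rw [h3]
    ring
  -- termwise domination of the convolution on (α, ∞)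
  have hterm : ∀ s, α < s → ∀ p ∈ antidiagonal k, pole ν c p.1 s * pole ν c p.2 s ≤ e p.1 s * e p.2 s := by
    intro s hs p hp
    have hsum : p.1 + p.2 = k := mem_antidiagonal.mp hp
    rcases Nat.eq_zero_or_pos p.1 with h1 | h1
    · rw [h1, pole_zero, he.zero, zero_mul, zero_mul]
    rcases Nat.eq_zero_or_pos p.2 with h2 | h2
    · rw [h2, pole_zero, he.zero, mul_zero, mul_zero]
    exact mul_le_mul (hyp p.1 (by omega) s hs.le) (hyp p.2 (by omega) s hs.le)
      (pole_nonneg hν.le hc _ _) (le_trans (pole_nonneg hν.le hc _ _) (hyp p.1 (by omega) s hs.le))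
  -- φ = D − G is non-decreasing on [α, ∞)
  set D : ℝ → ℝ := fun s => exp (ν * (k : ℝ) ^ 2 * s) * e k s with hD
  have hφmono : MonotoneOn (fun s => D s - G s) (Ici α) := by
    refine monotoneOn_of_hasDerivWithinAt_nonneg
      (f' := fun s => exp (ν * (k : ℝ) ^ 2 * s) * ((1 / 2) * ∑ p ∈ antidiagonal k, e p.1 s * e p.2 s)
        - B * (exp (ν * ((k : ℝ) ^ 2 - k) * s) * (ν * ((k : ℝ) ^ 2 - k))))
      (convex_Ici α) ?_ (fun s hs => ?_) (fun s hs => ?_)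
    · exact ((continuousOn_weighted he k).mono (Ici_subset_Ici.mpr hα)).sub
        ((continuous_const.mul (continuous_exp.comp (continuous_const.mul continuous_id))).continuousOn)
    · rw [interior_Ici] at hs ⊢
      exact ((hasDerivAt_weighted he k (lt_of_le_of_lt hα hs)).sub (hG' s)).hasDerivWithinAt
    · rw [interior_Ici] at hs
      rw [hGconv s, ← mul_sub, ← mul_sub]
      refine mul_nonneg (exp_pos _).le (mul_nonneg (by norm_num) ?_)
      rw [sub_nonneg]
      exact sum_le_sum (hterm s hs)
  have hDα : 0 ≤ D α := mul_nonneg (exp_pos _).le (nonneg he hc k α hα)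
  have hmain : G t - G α ≤ D t := by
    have := hφmono (self_mem_Ici) (hαt.le : t ∈ Ici α) hαt.le
    simp only at this
    linarith
  -- the spare estimate: `G α · 2(k+1)/(k+2) ≤ G t`
  have hfrac : G α * (2 * ((k : ℝ) + 1) / ((k : ℝ) + 2)) ≤ G t := by
    have hwin : Real.log (2 * ((k : ℝ) + 1) / ((k : ℝ) + 2)) ≤ ν * ((k : ℝ) ^ 2 - k) * (t - α) := by
      have h1 : Real.log (2 * ((k : ℝ) + 1) / ((k : ℝ) + 2)) / (ν * (k : ℝ) * ((k : ℝ) - 1)) ≤ t - α := by linarith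
      have h2 : ν * (k : ℝ) * ((k : ℝ) - 1) = ν * ((k : ℝ) ^ 2 - k) := by ring
      rw [h2, div_le_iff₀ hνkk] at h1
      linarith
    have hexp : exp (ν * ((k : ℝ) ^ 2 - k) * α) * (2 * ((k : ℝ) + 1) / ((k : ℝ) + 2))
        ≤ exp (ν * ((k : ℝ) ^ 2 - k) * t) := by
      have : exp (ν * ((k : ℝ) ^ 2 - k) * α) * exp (Real.log (2 * ((k : ℝ) + 1) / ((k : ℝ) + 2))) ≤
          exp (ν * ((k : ℝ) ^ 2 - k) * α) * exp (ν * ((k : ℝ) ^ 2 - k) * (t - α)) :=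
        mul_le_mul_of_nonneg_left (exp_le_exp.mpr hwin) (exp_pos _).le
      rw [exp_log hratio_pos, ← exp_add] at this
      convert this using 2
      ring
    show B * exp (ν * ((k : ℝ) ^ 2 - k) * α) * (2 * ((k : ℝ) + 1) / ((k : ℝ) + 2)) ≤ B * exp (ν * ((k : ℝ) ^ 2 - k) * t)
    rw [mul_assoc]
    exact mul_le_mul_of_nonneg_left hexp hB0
  -- hence `D t ≥ (k/(2(k+1)))·G t`
  have hDlow : (k : ℝ) / (2 * ((k : ℝ) + 1)) * G t ≤ D t := by
    have hGα : G α ≤ ((k : ℝ) + 2) / (2 * ((k : ℝ) + 1)) * G t := by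
      have h := div_le_div_of_nonneg_right hfrac hratio_pos.le
      rw [mul_div_assoc, div_self hratio_pos.ne', mul_one] at h
      calc G α ≤ G t / (2 * ((k : ℝ) + 1) / ((k : ℝ) + 2)) := h
        _ = ((k : ℝ) + 2) / (2 * ((k : ℝ) + 1)) * G t := by
            rw [div_div_eq_mul_div]
            ring
    have hid : (k : ℝ) / (2 * ((k : ℝ) + 1)) * G t = G t - ((k : ℝ) + 2) / (2 * ((k : ℝ) + 1)) * G t := by
      have h2k : (2 : ℝ) * ((k : ℝ) + 1) ≠ 0 := by positivity
      field_simp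
      ring
    rw [hid]
    linarith
  have hidp : pole ν c k t = exp (-(ν * (k : ℝ) ^ 2 * t)) * ((k : ℝ) / (2 * ((k : ℝ) + 1)) * G t) := by
    show 24 * ν * (k : ℝ) * (c / (24 * ν)) ^ k * exp (-(ν * (k : ℝ) * t))
        = exp (-(ν * (k : ℝ) ^ 2 * t)) * ((k : ℝ) / (2 * ((k : ℝ) + 1)) * (B * exp (ν * ((k : ℝ) ^ 2 - k) * t)))
    have hsplit : exp (-(ν * (k : ℝ) * t)) = exp (-(ν * (k : ℝ) ^ 2 * t)) * exp (ν * ((k : ℝ) ^ 2 - k) * t) := by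
      rw [← exp_add]; congr 1; ring
    rw [hsplit, hB]
    have h2k : (2 : ℝ) * ((k : ℝ) + 1) ≠ 0 := by positivity
    field_simp
    ring
  rw [hidp]
  have hsplitD : e k t = exp (-(ν * (k : ℝ) ^ 2 * t)) * D t := by
    show e k t = exp (-(ν * (k : ℝ) ^ 2 * t)) * (exp (ν * (k : ℝ) ^ 2 * t) * e k t)
    rw [← mul_assoc, ← exp_add]; simp
  rw [hsplitD]
  exact mul_le_mul_of_nonneg_left hDlow (exp_pos _).le

/-! ### Schedules -/

/-- **POLE DOMINATION ALONG A SCHEDULE.** Let `β : ℕ → ℝ` with `β 1 = 0` and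
`β n + log(2(n+2)/(n+3))/(ν(n+1)n) ≤ β (n+1)` for every `n ≥ 1` (the window of mode `n+1` fits between `β n` and `β (n+1)`). Then
for every `k ≥ 1`, all modes `j ≤ k` dominate the pole profile from time `β k` on. [new here — MODEL] -/
theorem pole_le_of_schedule (he : IsSineCascade ν c e) (hν : 0 < ν) (hc : 0 ≤ c) (β : ℕ → ℝ) (hβ1 : β 1 = 0)
    (hstep : ∀ n : ℕ, 1 ≤ n →
      β n + Real.log (2 * ((n : ℝ) + 2) / ((n : ℝ) + 3)) / (ν * ((n : ℝ) + 1) * (n : ℝ)) ≤ β (n + 1)) :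
    ∀ k : ℕ, 1 ≤ k → ∀ j, j ≤ k → ∀ s, β k ≤ s → pole ν c j s ≤ e j s := by
  -- windows are positive, so the schedule is non-decreasing and nonnegative
  have hwpos : ∀ n : ℕ, 1 ≤ n → 0 < Real.log (2 * ((n : ℝ) + 2) / ((n : ℝ) + 3)) / (ν * ((n : ℝ) + 1) * (n : ℝ)) := by
    intro n hn
    have hnpos : (0 : ℝ) < n := by exact_mod_cast hn
    have hratio : 1 < 2 * ((n : ℝ) + 2) / ((n : ℝ) + 3) := by
      rw [lt_div_iff₀ (by positivity)]; linarith
    exact div_pos (Real.log_pos hratio) (by positivity)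
  have hmono : ∀ n : ℕ, 1 ≤ n → β n ≤ β (n + 1) := fun n hn => by linarith [hstep n hn, hwpos n hn]
  have hnonneg : ∀ n : ℕ, 1 ≤ n → 0 ≤ β n := by
    intro n hn
    induction n, hn using Nat.le_induction with
    | base => rw [hβ1]
    | succ m hm ih => exact le_trans ih (hmono m hm)
  intro k hk
  induction k, hk using Nat.le_induction with
  | base =>
    intro j hj s hs
    have hs0 : 0 ≤ s := by rw [hβ1] at hs; exact hs
    interval_cases j
    · rw [pole_zero, he.zero]
    · rw [pole_one hν.ne', mode_one he s hs0]
  | succ n hn ih =>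
    intro j hj s hs
    rcases Nat.lt_or_ge j (n + 1) with hlt | hge
    · exact ih j (by omega) s (le_trans (hmono n hn) hs)
    · have hjk : j = n + 1 := le_antisymm hj hge
      subst hjk
      have hcast : ∀ x : ℝ, Real.log (2 * (((n + 1 : ℕ) : ℝ) + 1) / (((n + 1 : ℕ) : ℝ) + 2)) /
          (x * ((n + 1 : ℕ) : ℝ) * (((n + 1 : ℕ) : ℝ) - 1))
          = Real.log (2 * ((n : ℝ) + 2) / ((n : ℝ) + 3)) / (x * ((n : ℝ) + 1) * (n : ℝ)) := by
        intro x
        push_cast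
        ring_nf
      refine lower_step_spare he hν hc (k := n + 1) (by omega) (hnonneg n hn)
        (fun i hi s' hs' => ih i (by omega) s' hs') (τ := β (n + 1) - β n) ?_ s (by linarith)
      rw [hcast ν]
      linarith [hstep n hn]

/-- **POLE LOWER BOUND FROM A BOUNDED SCHEDULE.** If moreover `β k ≤ S` for every `k ≥ 1`, then for every mode `k` and every `t ≥ S`:
`m_k(t) = 24ν k (c/24ν)^k e^{−νkt} ≤ e_k(t)`. [new here — MODEL] -/
theorem pole_lower_bound_of_schedule (he : IsSineCascade ν c e) (hν : 0 < ν) (hc : 0 ≤ c) (β : ℕ → ℝ) (hβ1 : β 1 = 0)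
    (hstep : ∀ n : ℕ, 1 ≤ n →
      β n + Real.log (2 * ((n : ℝ) + 2) / ((n : ℝ) + 3)) / (ν * ((n : ℝ) + 1) * (n : ℝ)) ≤ β (n + 1))
    {S : ℝ} (hS : ∀ k : ℕ, 1 ≤ k → β k ≤ S) :
    ∀ k : ℕ, ∀ t : ℝ, S ≤ t → pole ν c k t ≤ e k t := by
  intro k t ht
  rcases Nat.eq_zero_or_pos k with hk | hk
  · subst hk; rw [pole_zero, he.zero]
  · exact pole_le_of_schedule he hν hc β hβ1 hstep k hk k le_rfl t (le_trans (hS k hk) ht)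

/-- **BLOW-UP FROM A BOUNDED SCHEDULE.** Under the same hypotheses, if `24ν·e^{νS} ≤ c` then `k ↦ e_k(S)` is unbounded above
(`e_k(S) ≥ 24ν k (c e^{−νS}/24ν)^k ≥ 24ν k`). [new here — MODEL] -/
theorem unbounded_of_schedule (he : IsSineCascade ν c e) (hν : 0 < ν) (β : ℕ → ℝ) (hβ1 : β 1 = 0)
    (hstep : ∀ n : ℕ, 1 ≤ n →
      β n + Real.log (2 * ((n : ℝ) + 2) / ((n : ℝ) + 3)) / (ν * ((n : ℝ) + 1) * (n : ℝ)) ≤ β (n + 1))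
    {S : ℝ} (hS : ∀ k : ℕ, 1 ≤ k → β k ≤ S) (hcS : 24 * ν * exp (ν * S) ≤ c) :
    ∀ M : ℝ, ∃ k : ℕ, M < e k S := by
  intro M
  have hc : 0 ≤ c := le_trans (by positivity) hcS
  obtain ⟨k, hk⟩ := exists_nat_gt (M / (24 * ν))
  refine ⟨k, lt_of_lt_of_le ?_ (pole_lower_bound_of_schedule he hν hc β hβ1 hstep hS k S le_rfl)⟩
  -- `pole ν c k S = 24ν k (c e^{−νS}/(24ν))^k ≥ 24ν k > M`
  have hr : (1 : ℝ) ≤ c / (24 * ν) * exp (-(ν * S)) := by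
    have hpos : 0 < 24 * ν * exp (ν * S) := by positivity
    have h1 : 1 ≤ c / (24 * ν * exp (ν * S)) := by rw [le_div_iff₀ hpos]; linarith
    have h2 : c / (24 * ν * exp (ν * S)) = c / (24 * ν) * exp (-(ν * S)) := by
      rw [Real.exp_neg]
      field_simp
    rw [← h2]
    exact h1
  have hrk : (1 : ℝ) ≤ (c / (24 * ν) * exp (-(ν * S))) ^ k := one_le_pow₀ hr
  have h24 : M < 24 * ν * (k : ℝ) := by rw [div_lt_iff₀ (by positivity)] at hk; linarith
  have hpole : pole ν c k S = 24 * ν * (k : ℝ) * (c / (24 * ν) * exp (-(ν * S))) ^ k := by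
    have hexp : exp (-(ν * (k : ℝ) * S)) = exp (-(ν * S)) ^ k := by
      rw [← Real.exp_nat_mul]; congr 1; ring
    unfold pole
    rw [hexp, mul_pow]
    ring
  rw [hpole]
  nlinarith [mul_le_mul_of_nonneg_left hrk (by positivity : (0:ℝ) ≤ 24 * ν * (k : ℝ))]

/-! ### The closed-form schedule and the threshold `48 e^{−7/36} ν` -/

/-- `log((n+3)/(n+2)) ≥ 1/(n+3)`, i.e. the window `(log 2 − 1/(n+3))/(ν(n+1)n)` is admissible for mode `n+1`. [folklore] -/
private theorem log_window_le (n : ℕ) :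
    Real.log (2 * ((n : ℝ) + 2) / ((n : ℝ) + 3)) ≤ Real.log 2 - 1 / ((n : ℝ) + 3) := by
  have hx : 0 < ((n : ℝ) + 3) / ((n : ℝ) + 2) := by positivity
  have h1 := Real.one_sub_inv_le_log_of_pos hx
  rw [inv_div] at h1
  have h2 : Real.log (2 * ((n : ℝ) + 2) / ((n : ℝ) + 3)) = Real.log 2 - Real.log (((n : ℝ) + 3) / ((n : ℝ) + 2)) := by
    rw [Real.log_div (by positivity) (by positivity), Real.log_mul (by norm_num) (by positivity),
      Real.log_div (by positivity) (by positivity)]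
    ring
  have h3 : 1 - ((n : ℝ) + 2) / ((n : ℝ) + 3) = 1 / ((n : ℝ) + 3) := by
    field_simp
    ring
  rw [h3] at h1
  linarith

/-- **THE CLOSED-FORM SCHEDULE IS ADMISSIBLE AND BOUNDED BY `(log 2 − 7/36)/ν`.** With
`β k = (log 2·(1 − 1/k) − (7/36 − 1/(3k) + 1/(6(k+1)) + 1/(6(k+2))))/ν`: `β 1 = 0`, the step inequality of `pole_le_of_schedule` holds
(`β (n+1) − β n = (log 2 − 1/(n+3))/(ν(n+1)n)`), and `β k ≤ (log 2 − 7/36)/ν` for all `k ≥ 1` (`log 2 ≥ 1/3`). [new here — MODEL] -/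
theorem spareSchedule_spec (hν : 0 < ν) :
    (fun k : ℕ => (Real.log 2 * (1 - 1 / (k : ℝ))
        - (7 / 36 - 1 / (3 * (k : ℝ)) + 1 / (6 * ((k : ℝ) + 1)) + 1 / (6 * ((k : ℝ) + 2)))) / ν) 1 = 0 ∧
    (∀ n : ℕ, 1 ≤ n →
      (fun k : ℕ => (Real.log 2 * (1 - 1 / (k : ℝ))
        - (7 / 36 - 1 / (3 * (k : ℝ)) + 1 / (6 * ((k : ℝ) + 1)) + 1 / (6 * ((k : ℝ) + 2)))) / ν) n
        + Real.log (2 * ((n : ℝ) + 2) / ((n : ℝ) + 3)) / (ν * ((n : ℝ) + 1) * (n : ℝ))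
      ≤ (fun k : ℕ => (Real.log 2 * (1 - 1 / (k : ℝ))
        - (7 / 36 - 1 / (3 * (k : ℝ)) + 1 / (6 * ((k : ℝ) + 1)) + 1 / (6 * ((k : ℝ) + 2)))) / ν) (n + 1)) ∧
    (∀ k : ℕ, 1 ≤ k →
      (fun k : ℕ => (Real.log 2 * (1 - 1 / (k : ℝ))
        - (7 / 36 - 1 / (3 * (k : ℝ)) + 1 / (6 * ((k : ℝ) + 1)) + 1 / (6 * ((k : ℝ) + 2)))) / ν) k
      ≤ (Real.log 2 - 7 / 36) / ν) := by
  have hν0 : ν ≠ 0 := hν.ne'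
  refine ⟨?_, ?_, ?_⟩
  · norm_num
  · intro n hn
    have hnpos : (0 : ℝ) < n := by exact_mod_cast hn
    simp only
    -- `β (n+1) = β n + (log 2 − 1/(n+3))/(ν(n+1)n)` (partial fractions), and the window is shorter (`log_window_le`)
    have hdiff : (Real.log 2 * (1 - 1 / (((n + 1 : ℕ) : ℝ)))
          - (7 / 36 - 1 / (3 * ((n + 1 : ℕ) : ℝ)) + 1 / (6 * (((n + 1 : ℕ) : ℝ) + 1)) + 1 / (6 * (((n + 1 : ℕ) : ℝ) + 2)))) / ν
        = (Real.log 2 * (1 - 1 / (n : ℝ))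
          - (7 / 36 - 1 / (3 * (n : ℝ)) + 1 / (6 * ((n : ℝ) + 1)) + 1 / (6 * ((n : ℝ) + 2)))) / ν
          + (Real.log 2 - 1 / ((n : ℝ) + 3)) / (ν * ((n : ℝ) + 1) * (n : ℝ)) := by
      push_cast
      field_simp
      ring
    rw [hdiff]
    have hden : 0 < ν * ((n : ℝ) + 1) * (n : ℝ) := by positivity
    have := div_le_div_of_nonneg_right (log_window_le n) hden.le
    linarith
  · intro k hk
    have hkpos : (0 : ℝ) < k := by exact_mod_cast hk
    simp only
    refine div_le_div_of_nonneg_right ?_ hν.le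
    have hL : (1 : ℝ) / 3 ≤ Real.log 2 := by linarith [Real.log_two_gt_d9]
    have h1 : 1 / (3 * (k : ℝ)) ≤ Real.log 2 / (k : ℝ) := by
      rw [div_le_div_iff₀ (by positivity) hkpos]
      nlinarith
    have h2 : 0 ≤ 1 / (6 * ((k : ℝ) + 1)) := by positivity
    have h3 : 0 ≤ 1 / (6 * ((k : ℝ) + 2)) := by positivity
    have h4 : Real.log 2 * (1 - 1 / (k : ℝ)) = Real.log 2 - Real.log 2 / (k : ℝ) := by ring
    rw [h4]
    linarith

/-- **POLE LOWER BOUND FROM `t = (log 2 − 7/36)/ν` ON.** For the sine-datum cascade with `ν > 0`, `c ≥ 0`: for every mode `k` and every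
`t ≥ (log 2 − 7/36)/ν`,  `24ν k (c/24ν)^k e^{−νkt} ≤ e_k(t)` (`pole_lower_bound` needed `t ≥ log 2/ν`). [new here — MODEL] -/
theorem pole_lower_bound_spare (he : IsSineCascade ν c e) (hν : 0 < ν) (hc : 0 ≤ c) :
    ∀ k : ℕ, ∀ t : ℝ, (Real.log 2 - 7 / 36) / ν ≤ t → pole ν c k t ≤ e k t := by
  obtain ⟨h1, h2, h3⟩ := spareSchedule_spec hν
  exact pole_lower_bound_of_schedule he hν hc _ h1 h2 h3

/-- **FINITE-TIME BLOW-UP FOR `c ≥ 48 e^{−7/36} ν` (coefficient form).** The sine-datum cascade is unbounded in `k` at the fixed time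
`t₁ = (log 2 − 7/36)/ν ≈ 0.4987/ν` whenever `48 e^{−7/36} ν ≤ c` (`48 e^{−7/36} = 39.518…`). [new here — MODEL] -/
theorem unbounded_of_le_spare (he : IsSineCascade ν c e) (hν : 0 < ν) (hc : 48 * exp (-(7 / 36)) * ν ≤ c) :
    ∀ M : ℝ, ∃ k : ℕ, M < e k ((Real.log 2 - 7 / 36) / ν) := by
  obtain ⟨h1, h2, h3⟩ := spareSchedule_spec hν
  refine unbounded_of_schedule he hν _ h1 h2 h3 ?_
  have hexp : exp (ν * ((Real.log 2 - 7 / 36) / ν)) = 2 * exp (-(7 / 36)) := by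
    rw [mul_div_cancel₀ _ hν.ne', sub_eq_add_neg, Real.exp_add, Real.exp_log (by norm_num)]
  rw [hexp]
  linarith

/-- `48 e^{−7/36} ≤ 40` (from `e^{7/36} ≥ 1 + 7/36 + (7/36)²/2 ≥ 6/5`). -/
private theorem fortyEight_exp_le_forty : 48 * exp (-(7 / 36 : ℝ)) ≤ 40 := by
  have hq := Real.quadratic_le_exp_of_nonneg (by norm_num : (0 : ℝ) ≤ 7 / 36)
  have h65 : (6 : ℝ) / 5 ≤ exp (7 / 36) := le_trans (by norm_num) hq
  have hinv : (exp (7 / 36 : ℝ))⁻¹ ≤ ((6 : ℝ) / 5)⁻¹ := inv_anti₀ (by norm_num) h65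
  rw [Real.exp_neg]
  calc 48 * (exp (7 / 36 : ℝ))⁻¹ ≤ 48 * ((6 : ℝ) / 5)⁻¹ := by gcongr
    _ = 40 := by norm_num

/-- **FINITE-TIME BLOW-UP FOR `c ≥ 40ν` (coefficient form, datum-free kernel constant `48 → 40`).** [new here — MODEL] -/
theorem unbounded_of_le_forty (he : IsSineCascade ν c e) (hν : 0 < ν) (hc : 40 * ν ≤ c) :
    ∀ M : ℝ, ∃ k : ℕ, M < e k ((Real.log 2 - 7 / 36) / ν) :=
  unbounded_of_le_spare he hν (le_trans (by nlinarith [fortyEight_exp_le_forty, hν]) hc)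

/-- **Contrapositive (census form).** A sine-datum cascade bounded in `k` at time `(log 2 − 7/36)/ν` has `c < 40ν`. [new here — MODEL] -/
theorem datum_lt_forty_of_bounded (he : IsSineCascade ν c e) (hν : 0 < ν)
    (hbdd : ∃ M : ℝ, ∀ k : ℕ, e k ((Real.log 2 - 7 / 36) / ν) ≤ M) : c < 40 * ν := by
  by_contra h
  obtain ⟨M, hM⟩ := hbdd
  obtain ⟨k, hk⟩ := unbounded_of_le_forty he hν (not_lt.mp h) M
  exact absurd (hM k) (not_le.mpr hk)

/-! ### PDE level -/

/-- **No classical solution from `−c sin x`, `c ≥ 48e^{−7/36}ν`, survives to `t = (log 2 − 7/36)/ν`.** [new here — MODEL] -/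
theorem horizon_lt_of_le_spare {T : ℝ} {ω ωt ωx ωxx : ℝ → ℝ → ℝ} (h : IsClassicalSolution ν T ω ωt ωx ωxx)
    (hω0 : ∀ x, ω 0 x = -c * Real.sin x) (hν : 0 < ν) (hc : 48 * exp (-(7 / 36)) * ν ≤ c) :
    T < (Real.log 2 - 7 / 36) / ν := by
  have hτ : 0 < (Real.log 2 - 7 / 36) / ν := div_pos (by linarith [Real.log_two_gt_d9]) hν
  exact horizon_lt_of_cascade_unbounded h hω0 hτ fun e he => unbounded_of_le_spare he hν hc

/-- **No classical `2π`-periodic solution of `ω_t = ω·Hω + ν ω_xx` from `−c sin x` with `c ≥ 40ν` exists on `[0, (log 2 − 7/36)/ν]`**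
(`(log 2 − 7/36)/ν ≈ 0.4987/ν`; datum-free kernel constant, was `48ν` / `log 2/ν` in `horizon_lt_log_two_div`). [new here — MODEL] -/
theorem horizon_lt_of_le_forty {T : ℝ} {ω ωt ωx ωxx : ℝ → ℝ → ℝ} (h : IsClassicalSolution ν T ω ωt ωx ωxx)
    (hω0 : ∀ x, ω 0 x = -c * Real.sin x) (hν : 0 < ν) (hc : 40 * ν ≤ c) :
    T < (Real.log 2 - 7 / 36) / ν :=
  horizon_lt_of_le_spare h hω0 hν (le_trans (by nlinarith [fortyEight_exp_le_forty, hν]) hc)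

end SheetNSLineTorusCascade
end Summit.NavierStokesRegularity.OSWSelfSimilar
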